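import Mathlib
import HarnessLib
import Literature.Computability.AlgebraicComplexity.PatternExpressions
import Literature.Combinatorics.SimpleGraph.TreeDecomposition
import Summits.ValiantsHypothesis.ValiantsHypothesis.Theorems.MonotoneRestorationOrbitRestorationQPEvenNewton

/-!
# The product of the column Vandermondes lies in the treewidth-2 homomorphism algebra (SPAN currency, A_∞ lane)

Route MonotoneRestoration, crux `OrbitRestorationQP` (stmt-ValiantsHypothesis-18293), line `depth-three-rung`,
open sub-rung A_∞ = `stub_sigmaPiSigmaValue` (`ΣΠΣ` restoration).  Helper (`--supports`), def-free.

THE TEST FAMILY.  `W_n := Π_{q<n} V_q`, `V_q := det (vandermonde (x_{·,q})) = Π_{i<i'} (x_{i'q} − x_{iq})` (the column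
Vandermondes; up to the sign `(−1)^{C(n,2)}` per column these are the `D_q` of `…TermBlocksEvenVandermondes.lean`,
so `W_n = ± e_n(D)`).  For EVEN `n` it is matrix-symmetric, a `ΠΣ` family with `n·C(n,2)` affine factors whose
single line-orbit is TWISTED (a row transposition negates a factor), and it is quasi-polynomially ORBIT-restorable
(landed A₁ / `qpOrbitRestorable_evenESymm_columnVandermondes_uniform`).  In SPAN currency (the currency of
Dawar–Pago–Seppelt: linear combinations of homomorphism polynomials `hom_{F,n}` of bipartite patterns of small
treewidth; tree: `homPoly`, `PerNotNarrow.qpOrbit_of_mem_narrowSpan`, `HomPolyClose`) its monomials `x^D` (every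
column of `D` a permutation of `{0,…,n−1}`, coefficients `±1`) charge, in the volume-`≤ n` expansion, only patterns
of treewidth `≥ n/2`.  THIS FILE proves that with UNBOUNDED volume the treewidth drops to `2`:

**Theorem (`prod_colVandermonde_mem_adjoin_homPoly_tw_two`).**  For every `m`,
`W_{2m} ∈ Algebra.adjoin ℂ {hom_{F,2m} : F a bipartite pattern of treewidth ≤ 2}`.

Proof (kernel).  (1) Newton inside the EVEN subalgebra (landed `EvenNewton.esymm_mem_evenSubalgebra`):
`W_n = e_n(V_1,…,V_n)` is a polynomial in the even power sums `Σ_q V_q^{2j}` and the products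
`(Σ_q V_q^{2a+1})(Σ_q V_q^{2b+1})`.  (2) Cauchy–Binet / Gram: `V_q V_{q'} = det (Σ_i x_{iq}^j x_{iq'}^k)_{j,k}`
(`(vandermonde x)ᵀ · vandermonde y`), so `V_q^{2a+1} V_{q'}^{2b+1}` and `V_q^{2j}` are FIXED polynomials in the
bi-column power sums `p_{cd}(q,q') = Σ_i x_{iq}^c x_{iq'}^d` (`aeval_mixGram`, `aeval_leftGram`, `aeval_rightGram`).
(3) For every list of exponent pairs `f : Fin N → ℕ × ℕ`, `Σ_{q,q'} Π_t p_{f t}(q,q')` IS the homomorphism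
polynomial of the pattern on `Fin N × Fin 2` joining the fresh row vertex `t` to the two column vertices with
multiplicities `(f t).1, (f t).2` (`homPoly_biColumnPattern`), whose pattern graph has the path decomposition with
bags `{t, col₀, col₁}`, hence treewidth `≤ 2` (`treewidth_biColumnPattern_le_two`).  (4) Summing a fixed polynomial
in the `p_{cd}(q,q')` over all `(q,q')` lands in the algebra generated by these hom polynomials
(`sum_sum_aeval_mem`, monomial by monomial: `exists_prod_pow_eq_prod_fin`).

Census value (honest): an INSTANCE, not a stub.  It decides the test question of the crux evidence note
`SPAN-CURRENCY-A1-g7g4.md` (§2 Step 8): twisted `ΠΣ` orbits are narrow with CONSTANT treewidth once the volume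
of the patterns is unbounded (here the patterns have up to `≈ n³` row vertices), the mechanism being Newton in the
even subalgebra + bi-column power sums with FRESH row vertices.  No stub is closed; VP ≠ VNP is not touched.
-/

noncomputable section

-- `Summit.ValiantsHypothesis.ValiantsHypothesis.…` is the tree's single-conjunct layout (Sub = Summit).
set_option linter.dupNamespace false

namespace Summit.ValiantsHypothesis.ValiantsHypothesis.Theorems

namespace ColumnVandermondesNarrow

open MvPolynomial Finset Matrix
open Literature.Computability.AlgebraicComplexity (homPoly)
open Literature.Combinatorics.SimpleGraph (treewidth treewidth_le_of_intervals treewidth_le_card_sub_one)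

/-! ### (4a) Listing a monomial: `Π_{i ∈ s} g_i^{k_i} = Π_{t < N} g_{f t}` uniformly in `g` -/

/-- A product of powers over a finite set is a product over `Fin N` along a fixed enumeration with
multiplicities (uniformly in the values `g`). [folklore] -/
theorem exists_prod_pow_eq_prod_fin {ι : Type*} [DecidableEq ι] (R : Type*) [CommMonoid R]
    (k : ι → ℕ) (s : Finset ι) :
    ∃ (N : ℕ) (f : Fin N → ι), ∀ g : ι → R, ∏ i ∈ s, g i ^ k i = ∏ t : Fin N, g (f t) := by
  induction s using Finset.induction_on with
  | empty => exact ⟨0, Fin.elim0, fun g => by simp⟩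
  | insert a s ha ih =>
    obtain ⟨N, f, hf⟩ := ih
    refine ⟨k a + N, Fin.append (fun _ : Fin (k a) => a) f, fun g => ?_⟩
    rw [Finset.prod_insert ha, hf g, Fin.prod_univ_add]
    simp [Fin.append_left, Fin.append_right]

/-! ### (3) The bi-column patterns: their homomorphism polynomials and their treewidth -/

/-- **The homomorphism polynomial of a bi-column pattern.**  For `f : Fin N → ℕ × ℕ`, the pattern on
`Fin N × Fin 2` with `(f t).1` edges `(t,0)` and `(f t).2` edges `(t,1)` has
`hom = Σ_{q,q'} Π_t Σ_i x_{iq}^{(f t).1} x_{iq'}^{(f t).2}` (each fresh row vertex `t` is summed out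
independently). [cite: DwivediPagoSeppelt2026, eq. (1)] -/
theorem homPoly_biColumnPattern (n N : ℕ) (f : Fin N → ℕ × ℕ) :
    homPoly (∑ t : Fin N, (Multiset.replicate (f t).1 ((t, 0) : Fin N × Fin 2) +
      Multiset.replicate (f t).2 ((t, 1) : Fin N × Fin 2))) n ℂ =
    ∑ q : Fin n, ∑ q' : Fin n, ∏ t : Fin N,
      ∑ i : Fin n, (X (i, q) : MvPolynomial (Fin n × Fin n) ℂ) ^ (f t).1 * X (i, q') ^ (f t).2 := by
  unfold homPoly
  have hprod : ∀ h : (Fin N → Fin n) × (Fin 2 → Fin n),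
      ((∑ t : Fin N, (Multiset.replicate (f t).1 ((t, 0) : Fin N × Fin 2) +
          Multiset.replicate (f t).2 ((t, 1) : Fin N × Fin 2))).map
        fun e => (X (h.1 e.1, h.2 e.2) : MvPolynomial (Fin n × Fin n) ℂ)).prod =
      ∏ t : Fin N, (X (h.1 t, h.2 0) : MvPolynomial (Fin n × Fin n) ℂ) ^ (f t).1 *
        X (h.1 t, h.2 1) ^ (f t).2 := by
    intro h
    rw [show ((∑ t : Fin N, (Multiset.replicate (f t).1 ((t, 0) : Fin N × Fin 2) +
          Multiset.replicate (f t).2 ((t, 1) : Fin N × Fin 2))).map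
          fun e => (X (h.1 e.1, h.2 e.2) : MvPolynomial (Fin n × Fin n) ℂ)) =
        ∑ t : Fin N, (Multiset.replicate (f t).1 ((t, 0) : Fin N × Fin 2) +
          Multiset.replicate (f t).2 ((t, 1) : Fin N × Fin 2)).map
          fun e => (X (h.1 e.1, h.2 e.2) : MvPolynomial (Fin n × Fin n) ℂ) from
      map_sum (Multiset.mapAddMonoidHom fun e : Fin N × Fin 2 =>
        (X (h.1 e.1, h.2 e.2) : MvPolynomial (Fin n × Fin n) ℂ)) _ _, Multiset.prod_sum]
    refine Finset.prod_congr rfl fun t _ => ?_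
    rw [Multiset.map_add, Multiset.prod_add, Multiset.map_replicate, Multiset.map_replicate,
      Multiset.prod_replicate, Multiset.prod_replicate]
  simp_rw [hprod]
  rw [Fintype.sum_prod_type_right]
  have hinner : ∀ h₂ : Fin 2 → Fin n,
      ∑ h₁ : Fin N → Fin n, ∏ t : Fin N, (X (h₁ t, h₂ 0) : MvPolynomial (Fin n × Fin n) ℂ) ^ (f t).1 *
          X (h₁ t, h₂ 1) ^ (f t).2 =
        ∏ t : Fin N, ∑ i : Fin n, (X (i, h₂ 0) : MvPolynomial (Fin n × Fin n) ℂ) ^ (f t).1 *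
          X (i, h₂ 1) ^ (f t).2 := by
    intro h₂
    rw [Finset.prod_univ_sum]
    simp only [Fintype.piFinset_univ]
  simp_rw [hinner]
  rw [← (piFinTwoEquiv fun _ : Fin 2 => Fin n).symm.sum_comp, Fintype.sum_prod_type]
  rfl

/-- **Bi-column patterns have treewidth `≤ 2`:** the bags `{t, col₀, col₁}` along the path `t = 0, …, N-1`
form a tree decomposition of the pattern graph (every edge joins a row vertex `t` to a column vertex).
[folklore] -/
theorem treewidth_biColumnPattern_le_two (N : ℕ) (f : Fin N → ℕ × ℕ) :
    treewidth (SimpleGraph.fromRel fun u v : Fin N ⊕ Fin 2 =>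
      ∃ e ∈ (∑ t : Fin N, (Multiset.replicate (f t).1 ((t, 0) : Fin N × Fin 2) +
        Multiset.replicate (f t).2 ((t, 1) : Fin N × Fin 2))), u = Sum.inl e.1 ∧ v = Sum.inr e.2) ≤ 2 := by
  cases N with
  | zero =>
    refine (treewidth_le_card_sub_one _).trans ?_
    simp
  | succ k =>
    refine treewidth_le_of_intervals _
      (fun t : Fin (k + 1) => ({Sum.inl t, Sum.inr 0, Sum.inr 1} : Finset (Fin (k + 1) ⊕ Fin 2)))
      ?_ ?_ ?_ (fun t => Finset.card_le_three)
    · -- every edge `{inl t, inr j}` lies in the bag of `t`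
      intro u v huv
      rw [SimpleGraph.fromRel_adj] at huv
      obtain ⟨-, h | h⟩ := huv
      · obtain ⟨e, -, rfl, rfl⟩ := h
        refine ⟨e.1, by simp, ?_⟩
        rcases Fin.exists_fin_two.mp ⟨e.2, rfl⟩ with h2 | h2 <;> simp [h2]
      · obtain ⟨e, -, rfl, rfl⟩ := h
        refine ⟨e.1, ?_, by simp⟩
        rcases Fin.exists_fin_two.mp ⟨e.2, rfl⟩ with h2 | h2 <;> simp [h2]
    · -- every vertex lies in a bag
      rintro (t | j)
      · exact ⟨t, by simp⟩
      · refine ⟨0, ?_⟩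
        rcases Fin.exists_fin_two.mp ⟨j, rfl⟩ with h2 | h2 <;> simp [h2]
    · -- the bags containing a vertex form an interval
      rintro (t | j)
      · have : {s : Fin (k + 1) | (Sum.inl t : Fin (k + 1) ⊕ Fin 2) ∈
            ({Sum.inl s, Sum.inr 0, Sum.inr 1} : Finset (Fin (k + 1) ⊕ Fin 2))} = {t} := by
          ext s
          simp [eq_comm]
        rw [this]
        exact Set.ordConnected_singleton
      · have : {s : Fin (k + 1) | (Sum.inr j : Fin (k + 1) ⊕ Fin 2) ∈
            ({Sum.inl s, Sum.inr 0, Sum.inr 1} : Finset (Fin (k + 1) ⊕ Fin 2))} = Set.univ := by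
          ext s
          rcases Fin.exists_fin_two.mp ⟨j, rfl⟩ with h2 | h2 <;> simp [h2]
        rw [this]
        exact Set.ordConnected_univ

/-! ### (4b) Summing a fixed polynomial in the bi-column power sums over all column pairs -/

/-- **Sums over column pairs of polynomials in the bi-column power sums lie in any subalgebra containing the
bi-column hom polynomials.**  If `A` contains `Σ_{q,q'} Π_t p_{f t}(q,q')` for every exponent list `f`, then for
every polynomial `F` in variables indexed by `ℕ × ℕ`,
`Σ_{q,q'} F(p_{cd}(q,q')) ∈ A` (expand `F` into monomials). [folklore] -/
theorem sum_sum_aeval_mem (n : ℕ) (A : Subalgebra ℂ (MvPolynomial (Fin n × Fin n) ℂ))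
    (hA : ∀ (N : ℕ) (f : Fin N → ℕ × ℕ),
      (∑ q : Fin n, ∑ q' : Fin n, ∏ t : Fin N,
        ∑ i : Fin n, (X (i, q) : MvPolynomial (Fin n × Fin n) ℂ) ^ (f t).1 * X (i, q') ^ (f t).2) ∈ A)
    (F : MvPolynomial (ℕ × ℕ) ℂ) :
    (∑ q : Fin n, ∑ q' : Fin n,
      aeval (fun cd : ℕ × ℕ => ∑ i : Fin n,
        (X (i, q) : MvPolynomial (Fin n × Fin n) ℂ) ^ cd.1 * X (i, q') ^ cd.2) F) ∈ A := by
  rw [F.as_sum]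
  simp_rw [map_sum]
  simp_rw [Finset.sum_comm (t := F.support)]
  refine Subalgebra.sum_mem _ fun s _ => ?_
  -- one monomial `monomial s (coeff s F)`
  obtain ⟨N, f, hf⟩ := exists_prod_pow_eq_prod_fin (MvPolynomial (Fin n × Fin n) ℂ) s s.support
  have hmon : ∀ q q' : Fin n,
      aeval (fun cd : ℕ × ℕ => ∑ i : Fin n,
        (X (i, q) : MvPolynomial (Fin n × Fin n) ℂ) ^ cd.1 * X (i, q') ^ cd.2) (monomial s (coeff s F)) =
      C (coeff s F) * ∏ t : Fin N, ∑ i : Fin n,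
        (X (i, q) : MvPolynomial (Fin n × Fin n) ℂ) ^ (f t).1 * X (i, q') ^ (f t).2 := by
    intro q q'
    rw [aeval_monomial, Finsupp.prod, hf, MvPolynomial.algebraMap_eq]
  simp_rw [hmon, ← Finset.mul_sum]
  have hC : (C (coeff s F) : MvPolynomial (Fin n × Fin n) ℂ) ∈ A := by
    rw [← MvPolynomial.algebraMap_eq]
    exact A.algebraMap_mem _
  exact A.mul_mem hC (hA N f)

/-! ### (2) Gram / Cauchy–Binet: products of two column Vandermondes are determinants in the bi-column power sums -/

/-- `(vandermonde x)ᵀ · vandermonde y` is the matrix of mixed power sums `(Σ_i x_i^j y_i^k)_{j,k}`. [folklore] -/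
theorem vandermonde_transpose_mul_vandermonde {R : Type*} [CommRing R] {n : ℕ} (x y : Fin n → R) :
    (vandermonde x)ᵀ * vandermonde y =
      of fun j k : Fin n => ∑ i : Fin n, x i ^ (j : ℕ) * y i ^ (k : ℕ) := by
  ext j k
  simp [Matrix.mul_apply, vandermonde_apply]

/-- **Gram form of a product of two Vandermondes** (Cauchy–Binet): `det (Σ_i x_i^j y_i^k)_{j,k} = V(x)·V(y)`.
[folklore] -/
theorem det_mixedPowerSums {R : Type*} [CommRing R] {n : ℕ} (x y : Fin n → R) :
    (of fun j k : Fin n => ∑ i : Fin n, x i ^ (j : ℕ) * y i ^ (k : ℕ)).det =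
      (vandermonde x).det * (vandermonde y).det := by
  rw [← vandermonde_transpose_mul_vandermonde, det_mul, det_transpose]

/-- Under the bi-column evaluation `z_{cd} ↦ p_{cd}(q,q') = Σ_i x_{iq}^c x_{iq'}^d` the generic matrix `(z_{jk})_{j,k<n}`
becomes the mixed Gram matrix, so its determinant becomes `V_q · V_{q'}`. [folklore] -/
theorem aeval_det_mix (n : ℕ) (q q' : Fin n) :
    aeval (fun cd : ℕ × ℕ => ∑ i : Fin n,
        (X (i, q) : MvPolynomial (Fin n × Fin n) ℂ) ^ cd.1 * X (i, q') ^ cd.2)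
      (of fun j k : Fin n => (X (((j : ℕ), (k : ℕ)) : ℕ × ℕ) : MvPolynomial (ℕ × ℕ) ℂ)).det =
    (vandermonde fun i : Fin n => (X (i, q) : MvPolynomial (Fin n × Fin n) ℂ)).det *
      (vandermonde fun i : Fin n => (X (i, q') : MvPolynomial (Fin n × Fin n) ℂ)).det := by
  rw [AlgHom.map_det, ← det_mixedPowerSums]
  congr 1
  ext j k
  simp [AlgHom.mapMatrix_apply, Matrix.map_apply]

/-- The same for the LEFT Gram matrix `(z_{j+k,0})`: its evaluation is `(Σ_i x_{iq}^{j+k})`, determinant `V_q²`.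
[folklore] -/
theorem aeval_det_left (n : ℕ) (q q' : Fin n) :
    aeval (fun cd : ℕ × ℕ => ∑ i : Fin n,
        (X (i, q) : MvPolynomial (Fin n × Fin n) ℂ) ^ cd.1 * X (i, q') ^ cd.2)
      (of fun j k : Fin n => (X ((((j : ℕ) + k), 0) : ℕ × ℕ) : MvPolynomial (ℕ × ℕ) ℂ)).det =
    (vandermonde fun i : Fin n => (X (i, q) : MvPolynomial (Fin n × Fin n) ℂ)).det *
      (vandermonde fun i : Fin n => (X (i, q) : MvPolynomial (Fin n × Fin n) ℂ)).det := by
  rw [AlgHom.map_det, ← det_mixedPowerSums]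
  congr 1
  ext j k
  simp [AlgHom.mapMatrix_apply, Matrix.map_apply, pow_add]

/-- The same for the RIGHT Gram matrix `(z_{0,j+k})`: determinant `V_{q'}²`. [folklore] -/
theorem aeval_det_right (n : ℕ) (q q' : Fin n) :
    aeval (fun cd : ℕ × ℕ => ∑ i : Fin n,
        (X (i, q) : MvPolynomial (Fin n × Fin n) ℂ) ^ cd.1 * X (i, q') ^ cd.2)
      (of fun j k : Fin n => (X ((0, ((j : ℕ) + k)) : ℕ × ℕ) : MvPolynomial (ℕ × ℕ) ℂ)).det =
    (vandermonde fun i : Fin n => (X (i, q') : MvPolynomial (Fin n × Fin n) ℂ)).det *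
      (vandermonde fun i : Fin n => (X (i, q') : MvPolynomial (Fin n × Fin n) ℂ)).det := by
  rw [AlgHom.map_det, ← det_mixedPowerSums]
  congr 1
  ext j k
  simp [AlgHom.mapMatrix_apply, Matrix.map_apply, pow_add]

/-- **`V_q^{2a+1} V_{q'}^{2b+1}` is the bi-column evaluation of a FIXED polynomial** (mixed Gram determinant times
powers of the two pure Gram determinants). [folklore] -/
theorem aeval_oddPair (n a b : ℕ) (q q' : Fin n) :
    aeval (fun cd : ℕ × ℕ => ∑ i : Fin n,
        (X (i, q) : MvPolynomial (Fin n × Fin n) ℂ) ^ cd.1 * X (i, q') ^ cd.2)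
      ((of fun j k : Fin n => (X (((j : ℕ), (k : ℕ)) : ℕ × ℕ) : MvPolynomial (ℕ × ℕ) ℂ)).det *
        (of fun j k : Fin n => (X ((((j : ℕ) + k), 0) : ℕ × ℕ) : MvPolynomial (ℕ × ℕ) ℂ)).det ^ a *
        (of fun j k : Fin n => (X ((0, ((j : ℕ) + k)) : ℕ × ℕ) : MvPolynomial (ℕ × ℕ) ℂ)).det ^ b) =
    (vandermonde fun i : Fin n => (X (i, q) : MvPolynomial (Fin n × Fin n) ℂ)).det ^ (2 * a + 1) *
      (vandermonde fun i : Fin n => (X (i, q') : MvPolynomial (Fin n × Fin n) ℂ)).det ^ (2 * b + 1) := by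
  rw [map_mul, map_mul, map_pow, map_pow, aeval_det_mix, aeval_det_left, aeval_det_right]
  ring

/-- **`V_q^{2j}` is the bi-column evaluation of a fixed polynomial** (a power of the left Gram determinant),
independently of `q'`. [folklore] -/
theorem aeval_evenPow (n j : ℕ) (q q' : Fin n) :
    aeval (fun cd : ℕ × ℕ => ∑ i : Fin n,
        (X (i, q) : MvPolynomial (Fin n × Fin n) ℂ) ^ cd.1 * X (i, q') ^ cd.2)
      ((of fun j k : Fin n => (X ((((j : ℕ) + k), 0) : ℕ × ℕ) : MvPolynomial (ℕ × ℕ) ℂ)).det ^ j) =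
    (vandermonde fun i : Fin n => (X (i, q) : MvPolynomial (Fin n × Fin n) ℂ)).det ^ (2 * j) := by
  rw [map_pow, aeval_det_left]
  ring

/-! ### (1) Newton in the even subalgebra and the assembly -/

/-- The top elementary symmetric polynomial is the product of all the variables. [folklore] -/
theorem esymm_card_eq_prod (σ : Type*) [Fintype σ] (R : Type*) [CommSemiring R] :
    esymm σ R (Fintype.card σ) = ∏ i : σ, (X i : MvPolynomial σ R) := by
  rw [MvPolynomial.esymm, ← Finset.card_univ, Finset.powersetCard_self, Finset.sum_singleton]

/-- **Abstract form.**  For even `n`, the product of the column Vandermondes lies in every subalgebra containing the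
bi-column hom polynomials `Σ_{q,q'} Π_t p_{f t}(q,q')` (Newton in the even subalgebra + Gram determinants).
[folklore; cite: Macdonald1995, §I.2] -/
theorem prod_colVandermonde_mem_of_biColumn (n : ℕ) (hn : Even n)
    (A : Subalgebra ℂ (MvPolynomial (Fin n × Fin n) ℂ))
    (hA : ∀ (N : ℕ) (f : Fin N → ℕ × ℕ),
      (∑ q : Fin n, ∑ q' : Fin n, ∏ t : Fin N,
        ∑ i : Fin n, (X (i, q) : MvPolynomial (Fin n × Fin n) ℂ) ^ (f t).1 * X (i, q') ^ (f t).2) ∈ A) :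
    (∏ q : Fin n, (vandermonde fun i : Fin n => (X (i, q) : MvPolynomial (Fin n × Fin n) ℂ)).det) ∈ A := by
  rcases Nat.eq_zero_or_pos n with rfl | hpos
  · simp
  obtain ⟨m, rfl⟩ := hn
  set V : Fin (m + m) → MvPolynomial (Fin (m + m) × Fin (m + m)) ℂ :=
    fun q => (vandermonde fun i : Fin (m + m) => (X (i, q) : MvPolynomial (Fin (m + m) × Fin (m + m)) ℂ)).det
    with hV
  -- Newton in the even subalgebra, pushed along `X q ↦ V q`
  have key := EvenNewton.esymm_mem_evenSubalgebra (σ := Fin (m + m)) (K := ℂ) m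
  rw [two_mul] at key
  set φ : MvPolynomial (Fin (m + m)) ℂ →ₐ[ℂ] MvPolynomial (Fin (m + m) × Fin (m + m)) ℂ := aeval V with hφ
  have hes : esymm (Fin (m + m)) ℂ (m + m) = ∏ q : Fin (m + m), X q := by
    simpa using esymm_card_eq_prod (Fin (m + m)) ℂ
  have hW : φ (esymm (Fin (m + m)) ℂ (m + m)) = ∏ q : Fin (m + m), V q := by
    rw [hes, map_prod]
    exact Finset.prod_congr rfl fun q _ => by rw [hφ, aeval_X]
  have hmap : φ (esymm (Fin (m + m)) ℂ (m + m)) ∈ Algebra.adjoin ℂ (φ ''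
      ((Set.range fun j : ℕ => psum (Fin (m + m)) ℂ (2 * j)) ∪
        Set.range fun ab : ℕ × ℕ => psum (Fin (m + m)) ℂ (2 * ab.1 + 1) * psum (Fin (m + m)) ℂ (2 * ab.2 + 1))) := by
    rw [Algebra.adjoin_image]
    exact Subalgebra.mem_map.2 ⟨_, key, rfl⟩
  rw [← hW]
  refine Algebra.adjoin_le ?_ hmap
  -- the generators go to `A`
  have hpsum : ∀ k : ℕ, φ (psum (Fin (m + m)) ℂ k) = ∑ q : Fin (m + m), V q ^ k := by
    intro k
    simp only [hφ, MvPolynomial.psum, map_sum, map_pow, aeval_X]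
  have hne : ((m + m : ℕ) : ℂ) ≠ 0 := by exact_mod_cast hpos.ne'
  -- even power sums
  have hG1 : ∀ j : ℕ, (∑ q : Fin (m + m), V q ^ (2 * j)) ∈ A := by
    intro j
    have h := sum_sum_aeval_mem (m + m) A hA
      ((of fun j' k : Fin (m + m) => (X ((((j' : ℕ) + k), 0) : ℕ × ℕ) : MvPolynomial (ℕ × ℕ) ℂ)).det ^ j)
    simp_rw [aeval_evenPow] at h
    simp only [Finset.sum_const, Finset.card_univ, Fintype.card_fin] at h
    rw [← Finset.smul_sum] at h
    have hS : (∑ q : Fin (m + m), V q ^ (2 * j)) =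
        ((m + m : ℕ) : ℂ)⁻¹ • ((m + m) • ∑ q : Fin (m + m), V q ^ (2 * j)) := by
      rw [← Nat.cast_smul_eq_nsmul ℂ, inv_smul_smul₀ hne]
    rw [hS]
    exact A.smul_mem h _
  -- products of two odd power sums
  have hG2 : ∀ a b : ℕ, (∑ q : Fin (m + m), V q ^ (2 * a + 1)) * (∑ q : Fin (m + m), V q ^ (2 * b + 1)) ∈ A := by
    intro a b
    have h := sum_sum_aeval_mem (m + m) A hA
      ((of fun j k : Fin (m + m) => (X (((j : ℕ), (k : ℕ)) : ℕ × ℕ) : MvPolynomial (ℕ × ℕ) ℂ)).det *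
        (of fun j k : Fin (m + m) => (X ((((j : ℕ) + k), 0) : ℕ × ℕ) : MvPolynomial (ℕ × ℕ) ℂ)).det ^ a *
        (of fun j k : Fin (m + m) => (X ((0, ((j : ℕ) + k)) : ℕ × ℕ) : MvPolynomial (ℕ × ℕ) ℂ)).det ^ b)
    simp_rw [aeval_oddPair] at h
    rwa [Finset.sum_mul_sum]
  rintro _ ⟨x, hx, rfl⟩
  rcases hx with ⟨j, rfl⟩ | ⟨⟨a, b⟩, rfl⟩
  · rw [SetLike.mem_coe, hpsum]
    exact hG1 j
  · rw [SetLike.mem_coe, map_mul, hpsum, hpsum]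
    exact hG2 a b

/-- **THEOREM.  The product of the column Vandermondes at an even level lies in the algebra generated by the
homomorphism polynomials of bipartite patterns of treewidth `≤ 2`** (volume unbounded).  SPAN-currency instance for
the twisted `ΠΣ` residue of A_∞: `W_{2m} = Π_{q<2m} Π_{i<i'} (x_{i',q} − x_{i,q})`. [folklore; cite:
DwivediPagoSeppelt2026, eq. (1) and §8; Macdonald1995, §I.2] -/
theorem prod_colVandermonde_mem_adjoin_homPoly_tw_two (m : ℕ) :
    (∏ q : Fin (2 * m), (vandermonde fun i : Fin (2 * m) =>
        (X (i, q) : MvPolynomial (Fin (2 * m) × Fin (2 * m)) ℂ)).det) ∈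
      Algebra.adjoin ℂ {p : MvPolynomial (Fin (2 * m) × Fin (2 * m)) ℂ |
        ∃ (a b : ℕ) (E : Multiset (Fin a × Fin b)),
          Literature.Combinatorics.SimpleGraph.treewidth
              (SimpleGraph.fromRel fun u v : Fin a ⊕ Fin b =>
                ∃ e ∈ E, u = Sum.inl e.1 ∧ v = Sum.inr e.2) ≤ 2 ∧
            p = homPoly E (2 * m) ℂ} := by
  refine prod_colVandermonde_mem_of_biColumn (2 * m) (even_two_mul m) _ fun N f => ?_
  refine Algebra.subset_adjoin ⟨N, 2, _, treewidth_biColumnPattern_le_two N f, ?_⟩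
  rw [homPoly_biColumnPattern]

/-- The same product written with the explicit Vandermonde factors `Π_{i} Π_{i' > i} (x_{i',q} − x_{i,q})`.
[folklore] -/
theorem prod_prod_sub_mem_adjoin_homPoly_tw_two (m : ℕ) :
    (∏ q : Fin (2 * m), ∏ i : Fin (2 * m), ∏ i' ∈ Ioi i,
        ((X (i', q) : MvPolynomial (Fin (2 * m) × Fin (2 * m)) ℂ) - X (i, q))) ∈
      Algebra.adjoin ℂ {p : MvPolynomial (Fin (2 * m) × Fin (2 * m)) ℂ |
        ∃ (a b : ℕ) (E : Multiset (Fin a × Fin b)),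
          Literature.Combinatorics.SimpleGraph.treewidth
              (SimpleGraph.fromRel fun u v : Fin a ⊕ Fin b =>
                ∃ e ∈ E, u = Sum.inl e.1 ∧ v = Sum.inr e.2) ≤ 2 ∧
            p = homPoly E (2 * m) ℂ} := by
  have h := prod_colVandermonde_mem_adjoin_homPoly_tw_two m
  simp_rw [det_vandermonde] at h
  exact h

end ColumnVandermondesNarrow

end Summit.ValiantsHypothesis.ValiantsHypothesis.Theorems

end
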